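import Literature.Computability.MetaComplexity.EFScaffold
import HarnessLib

/-!
# A faster soundness checker for gate-defining rules

The truth-table checker `FregeRule.check` (`EFScaffold.lean`) enumerates all assignments to
the metavariables of a rule. The step rules of the arithmetic layers are mostly *definitional*:
under the context `K = var 0`, premises `K ∨ (g ↔ body)` define gate metavariables `g` from
input and carry metavariables. `FregeRule.checkD r V ds` enumerates only the assignments to the
*free* metavariables `< V` and computes the defined ones along the user-supplied definition
list `ds` (each entry being one of the premises); `isSound_of_checkD` shows this suffices: under
an assignment making `K` true the conclusion `K ∨ _` holds, and under one making `K` false and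
all premises true the defined metavariables have their computed values.

## Content

* `PropForm.allVarsB`: a Boolean test of a predicate on all variables of a formula.
* `FregeRule.ofBits` / `testBit_ofBits`: an assignment below `V` as the bits of a number.
* `FregeRule.extend`, `FregeRule.checkD`, `FregeRule.isSound_of_checkD`.

[cite: CookReckhow1979, §2 (sound rule)] for the notion checked; the checker itself is
folklore (evaluation of a circuit under all inputs).
-/

namespace Literature.Computability.Complexity.PropForm

/-- Boolean test that all variables of a formula satisfy `p`. [folklore] -/
def allVarsB (p : ℕ → Bool) : PropForm ℕ → Bool
  | var x => p x
  | const _ => true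
  | neg φ => allVarsB p φ
  | conj φ ψ => allVarsB p φ && allVarsB p ψ
  | disj φ ψ => allVarsB p φ && allVarsB p ψ

/-- `allVarsB` is correct. [folklore] -/
theorem allVarsB_eq_true {p : ℕ → Bool} {φ : PropForm ℕ} (h : allVarsB p φ = true) :
    ∀ x ∈ φ.vars, p x = true := by
  induction φ with
  | var y => simpa [allVarsB, vars] using h
  | const b => simp [vars]
  | neg φ ih => simpa [vars] using ih (by simpa [allVarsB] using h)
  | conj φ ψ ihφ ihψ =>
    simp only [allVarsB, Bool.and_eq_true] at h
    simp only [vars, Finset.mem_union]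
    rintro x (hx | hx)
    exacts [ihφ h.1 x hx, ihψ h.2 x hx]
  | disj φ ψ ihφ ihψ =>
    simp only [allVarsB, Bool.and_eq_true] at h
    simp only [vars, Finset.mem_union]
    rintro x (hx | hx)
    exacts [ihφ h.1 x hx, ihψ h.2 x hx]

end Literature.Computability.Complexity.PropForm

namespace Literature.Computability.MetaComplexity

open _root_.Computability Complexity Complexity.PropForm

namespace FregeRule

/-- The number whose bits below `V` are given by `σ`. [folklore] -/
def ofBits : ℕ → (ℕ → Bool) → ℕ
  | 0, _ => 0
  | V + 1, σ => Nat.bit (σ 0) (ofBits V fun i => σ (i + 1))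

/-- The bits of `ofBits V σ` below `V` are `σ`. [folklore] -/
theorem testBit_ofBits : ∀ (V : ℕ) (σ : ℕ → Bool) (i : ℕ), i < V → (ofBits V σ).testBit i = σ i
  | 0, _, i, hi => absurd hi (Nat.not_lt_zero i)
  | V + 1, σ, 0, _ => by simp [ofBits]
  | V + 1, σ, i + 1, hi => by
    rw [ofBits, Nat.testBit_bit_succ]
    exact testBit_ofBits V _ i (by omega)

/-- `ofBits V σ < 2^V`. [folklore] -/
theorem ofBits_lt : ∀ (V : ℕ) (σ : ℕ → Bool), ofBits V σ < 2 ^ V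
  | 0, _ => Nat.one_pos
  | V + 1, σ => by
    have := ofBits_lt V fun i => σ (i + 1)
    rw [ofBits, Nat.bit_val, Nat.pow_succ]
    cases σ 0 <;> simp <;> omega

/-- Updating an assignment at one variable. [folklore] -/
def upd (σ : ℕ → Bool) (g : ℕ) (b : Bool) (i : ℕ) : Bool := if i = g then b else σ i

/-- Extending an assignment along a list of definitions `(g, body)`: `g` receives the value of
`body` under the assignment built so far. [folklore] -/
def extend : List (ℕ × PropForm ℕ) → (ℕ → Bool) → ℕ → Bool
  | [], σ => σ
  | d :: ds, σ => extend ds (upd σ d.1 (d.2.eval σ))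

/-- Scoping check of a definition list: every body only mentions variables `< V` or defined
earlier (listed in `gs`). [folklore] -/
def defsOK (V : ℕ) : List ℕ → List (ℕ × PropForm ℕ) → Bool
  | _, [] => true
  | gs, d :: ds => allVarsB (fun x => decide (x < V) || gs.contains x) d.2 && defsOK V (d.1 :: gs) ds

/-- The conclusion is under the context metavariable: `var 0 ∨ _`. [folklore] -/
def isCtx : PropForm ℕ → Bool
  | disj (var 0) _ => true
  | _ => false

/-- **The definitional-extension checker.** `r.checkD V ds = true` when: the conclusion has the
form `var 0 ∨ _`; every definition of `ds` is a premise `var 0 ∨ (var g ↔ body)` of `r`; the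
bodies are well scoped; all variables of `r` are `< V` or defined; and for every assignment to
the variables `< V`, extended along `ds`, the premises imply the conclusion.
[cite: CookReckhow1979, §2 (sound rule)] -/
def checkD (r : FregeRule) (V : ℕ) (ds : List (ℕ × PropForm ℕ)) : Bool :=
  decide (0 < V) && isCtx r.conclusion &&
    ds.all (fun d => r.premises.contains (disj (var 0) (biimp (var d.1) d.2))) &&
    defsOK V [] ds &&
    (r.conclusion :: r.premises).all
      (allVarsB fun x => decide (x < V) || (ds.map Prod.fst).contains x) &&
    (List.range (2 ^ V)).all fun a =>
      !(r.premises.all fun p => p.eval (extend ds (Nat.testBit a))) ||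
        r.conclusion.eval (extend ds (Nat.testBit a))

/-- The conclusion of a rule passing `isCtx` is `var 0 ∨ c`. [folklore] -/
theorem exists_eq_of_isCtx {φ : PropForm ℕ} (h : isCtx φ = true) : ∃ c, φ = disj (var 0) c := by
  match φ, h with
  | disj (var 0) c, _ => exact ⟨c, rfl⟩

/-- Agreement of the extension with an assignment satisfying the definitions: if `τ` agrees with
`σ` on the variables `< V` and on `gs`, the bodies of `ds` are scoped within these, and `σ`
satisfies `σ g = body(σ)` for every definition, then `extend ds τ` agrees with `σ` on the
variables `< V`, on `gs` and on the defined variables. [folklore] -/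
theorem extend_agree {V : ℕ} {σ : ℕ → Bool} :
    ∀ (ds : List (ℕ × PropForm ℕ)) (gs : List ℕ) (τ : ℕ → Bool),
      (∀ x, (x < V ∨ x ∈ gs) → τ x = σ x) → defsOK V gs ds = true →
      (∀ d ∈ ds, σ d.1 = d.2.eval σ) →
      ∀ x, (x < V ∨ x ∈ gs ∨ x ∈ ds.map Prod.fst) → extend ds τ x = σ x
  | [], gs, τ, hτ, _, _, x, hx => by
    rw [extend]
    exact hτ x (by simpa using hx)
  | d :: ds, gs, τ, hτ, hok, hdef, x, hx => by
    rw [extend]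
    simp only [defsOK, Bool.and_eq_true] at hok
    have hbody : d.2.eval τ = d.2.eval σ := eval_congr_vars fun v hv => by
      have := allVarsB_eq_true hok.1 v hv
      simp only [Bool.or_eq_true, decide_eq_true_eq, List.contains_iff_mem] at this
      exact hτ v this
    refine extend_agree ds (d.1 :: gs) (upd τ d.1 (d.2.eval τ)) (fun v hv => ?_) hok.2
      (fun d' hd' => hdef d' (List.mem_cons_of_mem _ hd')) x ?_
    · unfold upd
      split_ifs with hvg
      · rw [hvg, hbody, ← hdef d List.mem_cons_self]
      · rcases hv with hv | hv
        · exact hτ v (Or.inl hv)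
        · rcases List.mem_cons.1 hv with rfl | hv
          · exact absurd rfl hvg
          · exact hτ v (Or.inr hv)
    · simp only [List.map_cons, List.mem_cons] at hx ⊢
      tauto

/-- **A rule passing the definitional-extension check is sound.**
[cite: CookReckhow1979, §2 (sound rule)] -/
theorem isSound_of_checkD {r : FregeRule} {V : ℕ} {ds : List (ℕ × PropForm ℕ)}
    (h : r.checkD V ds = true) : r.IsSound := by
  simp only [checkD, Bool.and_eq_true, decide_eq_true_eq, List.all_eq_true] at h
  obtain ⟨⟨⟨⟨⟨hV, hctx⟩, hds⟩, hok⟩, hvars⟩, hall⟩ := h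
  obtain ⟨c, hc⟩ := exists_eq_of_isCtx hctx
  intro σ hprem
  by_cases hK : σ 0 = true
  · rw [hc]
    simp [eval, hK]
  · have hK' : σ 0 = false := by simpa using hK
    -- every definition holds under `σ`
    have hdef : ∀ d ∈ ds, σ d.1 = d.2.eval σ := by
      intro d hd
      have hp := hprem _ (List.contains_iff_mem.1 (hds d hd))
      simp only [eval, eval_biimp, hK', Bool.false_or] at hp
      simpa using hp
    -- the enumerated assignment agreeing with `σ` below `V`, and its extension
    set a := ofBits V σ with ha
    have hagree : ∀ x, (x < V ∨ x ∈ ([] : List ℕ) ∨ x ∈ ds.map Prod.fst) →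
        extend ds (Nat.testBit a) x = σ x :=
      extend_agree ds [] (Nat.testBit a) (fun x hx => by
        rcases hx with hx | hx
        · exact testBit_ofBits V σ x hx
        · simp at hx) hok hdef
    have heval : ∀ φ ∈ r.conclusion :: r.premises, φ.eval (extend ds (Nat.testBit a)) = φ.eval σ := by
      intro φ hφ
      refine eval_congr_vars fun v hv => hagree v ?_
      have := allVarsB_eq_true (hvars φ hφ) v hv
      simp only [Bool.or_eq_true, decide_eq_true_eq, List.contains_iff_mem] at this
      rcases this with hvV | hvd
      · exact Or.inl hvV
      · exact Or.inr (Or.inr hvd)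
    have himp := hall a (List.mem_range.2 (ofBits_lt V σ))
    have hp : (r.premises.all fun p => p.eval (extend ds (Nat.testBit a))) = true :=
      List.all_eq_true.2 fun p hp => by
        rw [heval p (List.mem_cons_of_mem _ hp)]
        exact hprem p hp
    rw [hp] at himp
    rw [← heval r.conclusion List.mem_cons_self]
    simpa using himp

end FregeRule

end Literature.Computability.MetaComplexity
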